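import Summits.Ventures.PackingBounds.Conjectures.DiploSimplexRiesz
import HarnessLib
import HarnessLib.Audit.Tags

/-!
# Conjecture B″ (typed): for `5 ≤ n ≤ 8` the diplo-simplex threshold is the first crossover with the Petersen ⊕ cross-polytope family

Framing: lottery ticket; floor = certified bounds/negative ranges. Venture `PackingBounds` (cell `pub-packcert`, seat `pub-packcert-energy`,
gen 26; lead STRUCTURE entry C-B′ → typing queue C-B″ after three registered predictions held: P-E13, P-E14 (A), (B)).

`petersenCrossValue n s` is the Riesz-`s` energy (ordered pairs, distance form as in `dipValue`) of the competitor `X_n` = Petersen code (10 points in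
`𝟙^⊥ ⊂ ℝ⁵`) ⊕ cross-polytope `β_{n-4}` of the complement — `2n + 2` points of `S^{n-1}` with distances `√(5/3)` (60 ordered pairs), `√(10/3)` (30), `2`
(`2(n-4)`), `√2` (`40(n-4) + 4(n-4)(n-5)`); kernel constructions: `Conjectures/DiploSimplexFive` (`n = 5`), `…Six` (`n = 6`), `…PetersenCross` (all `n`,
via `Configurations/OrthogonalSumConfig`). CLOSED-FORM CROSSOVERS `E_s(X_n) = E_s(D_n)` (float): `s_c(5) = 2` (exact tie), `s_c(6) = 4.0866`, `s_c(7) = 6.0565`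
(window closes again at `40.34`), `s_c(8) = 8.2182` (closes at `25.68`), `s_c(9) = 11.60` (closes at `17.48`), none for `n ≥ 10`.
REGISTERED MULTISTART EVIDENCE (72–192 starts; cell results/e3pt/diplo/threshold-probes-g26.json): the `(n, 2n+2)` optimum is `D_n` just below `s_c(n)` and `X_n`
just above it for `n = 6, 7, 8` (`s = 4.05 | 4.12`, `6 | 6.12`, `8.1 | 8.3`), `D_n` at the harmonic exponent for every `n = 6 … 12`, and beyond the far end of the
`X_7`, `X_8` windows generic configurations (not `D_n`) win — so for `5 ≤ n ≤ 8` the data say: `D_n` is optimal exactly for `s ≤ s_c(n)`. (At `n = 9` the optimal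
set is numerically NOT an interval — `Conjectures/DiploSimplexConjectureBCore`; hence the restriction `n ≤ 8`.)

TYPED: `ConjectureBsharp` — for `5 ≤ n ≤ 8` and `s > 0`: `DiploMinimises n s ↔ (∀ 0 < s' ≤ s, dipValue n s' ≤ petersenCrossValue n s')` (i.e. `s` is below the FIRST
crossover; the plain comparison `dipValue ≤ petersenCrossValue` at `s` alone would be wrong beyond the window ends `40.34` / `25.68`). Wiring: the right-hand side
fails at `(6, 6)`, `(6, 8)`, `(5, 4)` (closed-form inequalities below), matching the kernel facts `¬ DiploMinimises 6 6`, `¬ DiploMinimises 6 8`, `¬ DiploMinimises 5 4`.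

## References
* B. Ballinger et al., Experiment. Math. 18 (2009) 257–283, §3.4. [`BallingerEtAl2009`]
-/

noncomputable section

namespace Summit.Ventures.PackingBounds.Conjectures

/-- Riesz-`s` energy (ordered pairs, distance form) of the Petersen ⊕ cross-polytope competitor `X_n`, `n ≥ 5`:
`60 √(5/3)^{-s} + 30 √(10/3)^{-s} + 2(n-4) 2^{-s} + (40(n-4) + 4(n-4)(n-5)) √2^{-s}`. -/
def petersenCrossValue (n : ℕ) (s : ℝ) : ℝ :=
  60 * Real.sqrt (5 / 3) ^ (-s) + 30 * Real.sqrt (10 / 3) ^ (-s) + 2 * ((n : ℝ) - 4) * (2 : ℝ) ^ (-s) +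
    (40 * ((n : ℝ) - 4) + 4 * ((n : ℝ) - 4) * ((n : ℝ) - 5)) * Real.sqrt 2 ^ (-s)

/-- **CONJECTURE B″ (gen 26; lead C-B″).** For `5 ≤ n ≤ 8` and `s > 0`, the diplo-simplex minimises the Riesz-`s` energy among `(2n+2)`-point subsets of `S^{n-1}`
if and only if `D_n` is (weakly) below the competitor `X_n` at every exponent `s' ≤ s` — i.e. iff `s ≤ s_c(n)`, the first crossover (`2`, `4.0866`, `6.0565`, `8.2182`).
OPEN; registered multistart evidence P-E13/14/17/18, exact tie at `(5, 2)`, kernel negatives at `(5,4)`, `(6,6)`, `(6,8)`. -/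
@[conjecture] def ConjectureBsharp : Prop :=
  ∀ n : ℕ, 5 ≤ n → n ≤ 8 → ∀ s : ℝ, 0 < s →
    (DiploMinimises n s ↔ ∀ s' : ℝ, 0 < s' → s' ≤ s → dipValue n s' ≤ petersenCrossValue n s')

/-! ### Closed-form comparisons at even exponents (wiring) -/

/-- `√q ^ {-s} = (q^m)⁻¹` for `s = 2m`, `q ≥ 0`. [folklore] -/
private theorem sqrt_rpow_neg_of_eq {q : ℝ} (hq : 0 ≤ q) (m : ℕ) (s : ℝ) (hs : s = 2 * (m : ℝ)) :
    Real.sqrt q ^ (-s) = (q ^ m)⁻¹ := by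
  rw [hs, Real.rpow_neg (Real.sqrt_nonneg _), show (2 * (m : ℝ)) = ((2 * m : ℕ) : ℝ) by push_cast; ring, Real.rpow_natCast,
    pow_mul, Real.sq_sqrt hq]

/-- `2 ^ {-s} = (4^m)⁻¹` for `s = 2m`. [folklore] -/
private theorem two_rpow_neg_of_eq (m : ℕ) (s : ℝ) (hs : s = 2 * (m : ℝ)) : (2 : ℝ) ^ (-s) = ((4 : ℝ) ^ m)⁻¹ := by
  rw [hs, Real.rpow_neg (by norm_num), show (2 * (m : ℝ)) = ((2 * m : ℕ) : ℝ) by push_cast; ring, Real.rpow_natCast, pow_mul]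
  norm_num

/-- `petersenCrossValue n (2m)` in closed form. -/
theorem petersenCrossValue_of_eq (n : ℕ) (m : ℕ) (s : ℝ) (hs : s = 2 * (m : ℝ)) : petersenCrossValue n s =
    60 * (((5 : ℝ) / 3) ^ m)⁻¹ + 30 * (((10 : ℝ) / 3) ^ m)⁻¹ + 2 * ((n : ℝ) - 4) * ((4 : ℝ) ^ m)⁻¹ +
      (40 * ((n : ℝ) - 4) + 4 * ((n : ℝ) - 4) * ((n : ℝ) - 5)) * ((2 : ℝ) ^ m)⁻¹ := by
  rw [petersenCrossValue, sqrt_rpow_neg_of_eq (by norm_num) m s hs, sqrt_rpow_neg_of_eq (by norm_num) m s hs,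
    sqrt_rpow_neg_of_eq (by norm_num) m s hs, two_rpow_neg_of_eq m s hs]

/-- `dipValue n (2m)` in closed form (`n ≥ 1`). -/
theorem dipValue_of_eq (n : ℕ) (hn : 1 ≤ n) (m : ℕ) (s : ℝ) (hs : s = 2 * (m : ℝ)) : dipValue n s =
    (2 * n + 2 : ℝ) * (((4 : ℝ) ^ m)⁻¹ + n * (((2 + 2 / (n : ℝ)) ^ m)⁻¹) + n * (((2 - 2 / (n : ℝ)) ^ m)⁻¹)) := by
  have hn1 : (1 : ℝ) ≤ n := by exact_mod_cast hn
  have hp : 0 ≤ 2 + 2 / (n : ℝ) := by positivity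
  have hm : 0 ≤ 2 - 2 / (n : ℝ) := by
    have : 2 / (n : ℝ) ≤ 2 := by rw [div_le_iff₀ (by linarith)]; linarith
    linarith
  rw [dipValue, sqrt_rpow_neg_of_eq hp m s hs, sqrt_rpow_neg_of_eq hm m s hs, two_rpow_neg_of_eq m s hs]

/-- At `(n, s) = (6, 6)` the competitor is below the diplo-simplex: `petersenCrossValue 6 6 = 9933/400 < dipValue 6 6`. -/
theorem petersenCross_lt_dip_six_six : petersenCrossValue 6 6 < dipValue 6 6 := by
  rw [petersenCrossValue_of_eq 6 3 6 (by norm_num), dipValue_of_eq 6 (by norm_num) 3 6 (by norm_num)]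
  norm_num

/-- At `(6, 8)`: `petersenCrossValue 6 8 < dipValue 6 8`. -/
theorem petersenCross_lt_dip_six_eight : petersenCrossValue 6 8 < dipValue 6 8 := by
  rw [petersenCrossValue_of_eq 6 4 8 (by norm_num), dipValue_of_eq 6 (by norm_num) 4 8 (by norm_num)]
  norm_num

/-- At `(5, 4)`: `petersenCrossValue 5 4 = 1377/40 < 1661/48 = dipValue 5 4`. -/
theorem petersenCross_lt_dip_five_four : petersenCrossValue 5 4 < dipValue 5 4 := by
  rw [petersenCrossValue_of_eq 5 2 4 (by norm_num), dipValue_of_eq 5 (by norm_num) 2 4 (by norm_num)]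
  norm_num

/-- At `(5, 2)` the two values TIE: `petersenCrossValue 5 2 = dipValue 5 2 = 131/2`. -/
theorem petersenCross_eq_dip_five_two : petersenCrossValue 5 2 = dipValue 5 2 := by
  rw [petersenCrossValue_of_eq 5 1 2 (by norm_num), dipValue_of_eq 5 (by norm_num) 1 2 (by norm_num)]
  norm_num

/-- At the HARMONIC exponent of `n = 6` the diplo-simplex is below the competitor: `dipValue 6 4 < petersenCrossValue 6 4 = 931/20`. -/
theorem dip_lt_petersenCross_six_four : dipValue 6 4 < petersenCrossValue 6 4 := by
  rw [petersenCrossValue_of_eq 6 2 4 (by norm_num), dipValue_of_eq 6 (by norm_num) 2 4 (by norm_num)]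
  norm_num

/-- **Consistency of B″ with the kernel negatives**: B″ implies `¬ DiploMinimises 6 6`, `¬ DiploMinimises 6 8`, `¬ DiploMinimises 5 4`
(all three are theorems of the tree: `Conjectures/DiploSimplexSix`, `…Five`). -/
theorem conjectureBsharp_consistent (h : ConjectureBsharp) :
    ¬ DiploMinimises 6 6 ∧ ¬ DiploMinimises 6 8 ∧ ¬ DiploMinimises 5 4 := by
  refine ⟨fun h66 => ?_, fun h68 => ?_, fun h54 => ?_⟩
  · have := (h 6 (by norm_num) (by norm_num) 6 (by norm_num)).1 h66 6 (by norm_num) le_rfl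
    linarith [petersenCross_lt_dip_six_six]
  · have := (h 6 (by norm_num) (by norm_num) 8 (by norm_num)).1 h68 8 (by norm_num) le_rfl
    linarith [petersenCross_lt_dip_six_eight]
  · have := (h 5 (by norm_num) (by norm_num) 4 (by norm_num)).1 h54 4 (by norm_num) le_rfl
    linarith [petersenCross_lt_dip_five_four]

end Summit.Ventures.PackingBounds.Conjectures

end
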